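import Summits.Ventures.LatticeQCDFlow.Exactness.AcceptanceFromMeanEnergyViolation
import Summits.Ventures.LatticeQCDFlow.Exactness.InvolutiveMetropolisEnergyBound
import Summits.Ventures.LatticeQCDFlow.Exactness.Phi4FlowSquareIntegrableCeiling
import HarnessLib

/-!
# The exact flow sampler IS an involutive Metropolis on `X × X` (the swap), so its acceptance is
# floored by the JEFFREYS divergence: `ā ≥ 1 − √(1 − e^{−(D(π‖q̃) + D(q̃‖π))})` — never vacuous

HONEST FRAMING: exact (Metropolis-corrected) sampling algorithms for lattice gauge theory;
figures of merit are autocorrelation/cost numbers at stated couplings and volumes; no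
continuum-physics claim.  (SCALAR calibration rung S0-A: not a gauge result.)

Venture `LatticeQCDFlow` (cell pub-lqcd), topic `Exactness`; FANOUT row 2 (`s0-phi4`, FLOW arm).
NEW WORK of the cell (one change of viewpoint + the tree's involution floor; nothing is cited as a
fact; no definition).  The independence Metropolis step with target weight `w` and model `q̃`
— propose `y ∼ q̃`, accept with `min(1, b(y)/b(x))`, `b = w/q̃` — is the deterministic-proposal
(involutive) Metropolis step of row 2's `InvolutiveMetropolis` / `AcceptanceFromMeanEnergyViolation`
on the PRODUCT space `(X × X, μ ⊗ μ)` with the swap `Ψ(x, y) = (y, x)` (a measure-preserving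
involution) and the 'energy' `H(x, y) = −log w(x) − log q̃(y)`: indeed `e^{−H} = w(x) q̃(y)`,
`ΔH = H∘Ψ − H = log b(x) − log b(y)` and `min(1, e^{−ΔH}) = imhAcceptQ w q̃ x y` on the nose.  The
equilibrium mean of `ΔH` is the JEFFREYS (symmetrised Kullback–Leibler) divergence,

  `⟨ΔH⟩ = E_π[log b] − E_q̃[log b] = D(π‖q̃) + D(q̃‖π) =: J(π, q̃)`,

so the tree's Bretagnolle–Huber floor `involutive_acceptance_ge` gives, for EVERY flow with both
relative entropies finite,

  **`ā ≥ 1 − √(1 − e^{−J(π, q̃)})`**  (`ā = Z⁻¹ ∫ w(x) ∫ α(x, y) q̃(y)` the equilibrium acceptance),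

a floor that is NEVER VACUOUS (positive for every finite `J`), unlike the Pinsker-type floors
`ā ≥ 1 − √(2D)` of `Scaling/AcceptancePinskerFloor` (row 3, finite state; vacuous at `D ≥ ½`); for
`D(π‖q̃) ≈ D(q̃‖π) ≈ D` small it reads `ā ≳ 1 − √(2D)` as well.  The Pinsker companion
`ā ≥ 1 − √(J/2)` follows the same way from GEN-24 #8's `involutive_acceptance_ge_pinsker` (sequel).

## What is proved (general `(X, μ)`, `μ` s-finite; `w, q̃ > 0` measurable integrable, `∫ q̃ = 1`)

* `swapEnergy_exp_neg`, `deltaH_swap_eq`, `imhAcceptQ_eq_min_exp_neg_deltaH` — the dictionary;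
* `integral_exp_neg_swapEnergy` (`= Z`), `integral_deltaH_swapEnergy`
  (`= ∫ w log b − Z ∫ q̃ log b` when `w log b, q̃ log b ∈ L¹`); `jeffreys_eq_forwardKL_add_reverseKL`
  (`J = Z⁻¹∫ w log(w/(Zq̃)) + ∫ q̃ log(Zq̃/w)`: the two relative entropies in the tree's density form);
* **`imh_meanAccept_ge_jeffreys`** — `∫ w(x) (∫ imhAcceptQ w q̃ x y · q̃(y)) ≥ (1 − √(1 − e^{−J}))·Z`,
  `J = (∫ w log b)/Z − ∫ q̃ log b`;  **`imh_meanReject_le_jeffreys`** — `∫ w r ≤ √(1 − e^{−J})·Z`;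
* **`imh_integral_accept_mul_logWeightJump_sq_le`** — `∫∫ α (log b(x) − log b(y))² w(x)q̃(y) ≤ 8e^{−2}Z`
  for EVERY flow (the tree's Caracciolo–Pelissetto–Sokal involution energy bound through the dictionary);
* lattice φ⁴ (`λ > 0`, real `J`, any flow with `e^{−S} log b, q̃ log b ∈ L¹`):
  **`phi4Flow_meanAccept_ge_jeffreys`**.

NOT CLAIMED: the Pinsker constant (sequel); any comparison claiming this floor beats the one-sided
KL floors in general (it does iff `1 − e^{−J} < 2D`); values of `D`, `J`, `ā` for any network.
-/

namespace Summit.Ventures.LatticeQCDFlow.Exactness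

open Real MeasureTheory Filter Set
open Summit.Ventures.LatticeQCDFlow.Scoring

/-! ## §1 The dictionary: IMH = involutive Metropolis of the swap on `X × X` -/

section Dictionary

variable {X : Type*} {w q : X → ℝ}

/-- `e^{−H(x,y)} = w(x) q̃(y)` for `H(x, y) = −log w(x) − log q̃(y)` (`w, q̃ > 0`). -/
theorem swapEnergy_exp_neg (hw0 : ∀ t, 0 < w t) (hq0 : ∀ t, 0 < q t) (p : X × X) :
    Real.exp (-(-Real.log (w p.1) - Real.log (q p.2))) = w p.1 * q p.2 := by
  rw [show -(-Real.log (w p.1) - Real.log (q p.2)) = Real.log (w p.1) + Real.log (q p.2) by ring,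
    Real.exp_add, Real.exp_log (hw0 _), Real.exp_log (hq0 _)]

/-- `ΔH(x, y) = log b(x) − log b(y)` (`b = w/q̃`) for the swap. -/
theorem deltaH_swap_eq (hw0 : ∀ t, 0 < w t) (hq0 : ∀ t, 0 < q t) (p : X × X) :
    deltaH (fun z : X × X => -Real.log (w z.1) - Real.log (q z.2)) Prod.swap p
      = Real.log (w p.1 / q p.1) - Real.log (w p.2 / q p.2) := by
  unfold deltaH
  simp only [Prod.fst_swap, Prod.snd_swap]
  rw [Real.log_div (hw0 _).ne' (hq0 _).ne', Real.log_div (hw0 _).ne' (hq0 _).ne']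
  ring

/-- `min(1, e^{−ΔH(x,y)}) = imhAcceptQ w q̃ x y`: the involutive acceptance IS the IMH acceptance. -/
theorem imhAcceptQ_eq_min_exp_neg_deltaH (hw0 : ∀ t, 0 < w t) (hq0 : ∀ t, 0 < q t) (p : X × X) :
    min 1 (Real.exp (-deltaH (fun z : X × X => -Real.log (w z.1) - Real.log (q z.2)) Prod.swap p))
      = imhAcceptQ w q p.1 p.2 := by
  unfold imhAcceptQ
  congr 1
  rw [deltaH_swap_eq hw0 hq0, show -(Real.log (w p.1 / q p.1) - Real.log (w p.2 / q p.2))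
      = Real.log (w p.2 / q p.2) - Real.log (w p.1 / q p.1) by ring, ← Real.log_div
      (div_pos (hw0 _) (hq0 _)).ne' (div_pos (hw0 _) (hq0 _)).ne', Real.exp_log
      (div_pos (div_pos (hw0 _) (hq0 _)) (div_pos (hw0 _) (hq0 _)))]
  have h1 := (hw0 p.1).ne'
  have h2 := (hq0 p.1).ne'
  have h3 := (hw0 p.2).ne'
  have h4 := (hq0 p.2).ne'
  field_simp

end Dictionary

section General

variable {X : Type*} [MeasurableSpace X] {μ : Measure X} [SFinite μ] {w q : X → ℝ}

/-- `∫ e^{−H} d(μ⊗μ) = Z · ∫ q̃ = Z`. -/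
theorem integral_exp_neg_swapEnergy (hw0 : ∀ t, 0 < w t) (hq0 : ∀ t, 0 < q t)
    (hq1 : ∫ z, q z ∂μ = 1) :
    ∫ p, Real.exp (-(-Real.log (w p.1) - Real.log (q p.2))) ∂(μ.prod μ) = ∫ z, w z ∂μ := by
  simp_rw [swapEnergy_exp_neg hw0 hq0]
  rw [integral_prod_mul (μ := μ) (ν := μ) w q, hq1, mul_one]

/-- `∫ ΔH e^{−H} d(μ⊗μ) = ∫ w log b − Z ∫ q̃ log b` (`w log b, q̃ log b ∈ L¹`). -/
theorem integral_deltaH_swapEnergy (hw0 : ∀ t, 0 < w t) (hwi : Integrable w μ) (hq0 : ∀ t, 0 < q t)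
    (hqi : Integrable q μ) (hq1 : ∫ z, q z ∂μ = 1)
    (hwl : Integrable (fun t => Real.log (w t / q t) * w t) μ)
    (hql : Integrable (fun t => Real.log (w t / q t) * q t) μ) :
    Integrable (fun p : X × X => deltaH (fun z : X × X => -Real.log (w z.1) - Real.log (q z.2))
      Prod.swap p * Real.exp (-(-Real.log (w p.1) - Real.log (q p.2)))) (μ.prod μ) ∧
    ∫ p, deltaH (fun z : X × X => -Real.log (w z.1) - Real.log (q z.2)) Prod.swap p
        * Real.exp (-(-Real.log (w p.1) - Real.log (q p.2))) ∂(μ.prod μ)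
      = ∫ t, Real.log (w t / q t) * w t ∂μ - (∫ z, w z ∂μ) * ∫ t, Real.log (w t / q t) * q t ∂μ := by
  have e : (fun p : X × X => deltaH (fun z : X × X => -Real.log (w z.1) - Real.log (q z.2))
      Prod.swap p * Real.exp (-(-Real.log (w p.1) - Real.log (q p.2))))
      = fun p => (Real.log (w p.1 / q p.1) * w p.1) * q p.2 - w p.1 * (Real.log (w p.2 / q p.2) * q p.2) := by
    funext p
    rw [deltaH_swap_eq hw0 hq0, swapEnergy_exp_neg hw0 hq0]
    ring
  have hA : Integrable (fun p : X × X => (Real.log (w p.1 / q p.1) * w p.1) * q p.2) (μ.prod μ) :=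
    hwl.mul_prod hqi
  have hB : Integrable (fun p : X × X => w p.1 * (Real.log (w p.2 / q p.2) * q p.2)) (μ.prod μ) :=
    hwi.mul_prod hql
  rw [e]
  refine ⟨hA.sub hB, ?_⟩
  rw [integral_sub hA hB, integral_prod_mul (μ := μ) (ν := μ) (fun x => Real.log (w x / q x) * w x) q,
    integral_prod_mul (μ := μ) (ν := μ) w (fun y => Real.log (w y / q y) * q y), hq1, mul_one]

omit [SFinite μ] in
/-- **`J = D(π‖q̃) + D(q̃‖π)`** in the tree's density vocabulary (`FlowSamplerKLFloor`:
`D(π‖q̃) = Z⁻¹∫ w log(w/(Z q̃))`, and `D(q̃‖π) = ∫ q̃ log(Z q̃/w)`):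
`(∫ w log b)/Z − ∫ q̃ log b = Z⁻¹ ∫ w log(w/(Z q̃)) + ∫ q̃ log(Z q̃/w)` (`w log b, q̃ log b ∈ L¹`). -/
theorem jeffreys_eq_forwardKL_add_reverseKL (hw0 : ∀ t, 0 < w t) (hwi : Integrable w μ)
    (hq0 : ∀ t, 0 < q t) (hqi : Integrable q μ) (hq1 : ∫ z, q z ∂μ = 1)
    (hwl : Integrable (fun t => Real.log (w t / q t) * w t) μ)
    (hql : Integrable (fun t => Real.log (w t / q t) * q t) μ) :
    (∫ t, Real.log (w t / q t) * w t ∂μ) / (∫ z, w z ∂μ) - ∫ t, Real.log (w t / q t) * q t ∂μ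
      = (∫ t, w t * Real.log (w t / ((∫ z, w z ∂μ) * q t)) ∂μ) / (∫ z, w z ∂μ)
        + ∫ t, q t * Real.log ((∫ z, w z ∂μ) * q t / w t) ∂μ := by
  set Z := ∫ z, w z ∂μ with hZdef
  have hZ : 0 < Z := integral_pos_of_pos hw0 hwi hq1
  have e1 : ∀ t, w t * Real.log (w t / (Z * q t)) = Real.log (w t / q t) * w t - Real.log Z * w t := by
    intro t
    rw [show w t / (Z * q t) = (w t / q t) / Z by field_simp, Real.log_div (div_pos (hw0 t) (hq0 t)).ne' hZ.ne']
    ring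
  have e2 : ∀ t, q t * Real.log (Z * q t / w t) = Real.log Z * q t - Real.log (w t / q t) * q t := by
    intro t
    rw [show Z * q t / w t = Z / (w t / q t) by field_simp, Real.log_div hZ.ne' (div_pos (hw0 t) (hq0 t)).ne']
    ring
  simp_rw [e1, e2]
  rw [integral_sub hwl (hwi.const_mul _), integral_sub (hqi.const_mul _) hql, integral_const_mul,
    integral_const_mul, hq1, ← hZdef]
  field_simp
  ring

/-! ## §2 The Jeffreys floor on the acceptance -/

/-- **THE EXACT FLOW SAMPLER'S ACCEPTANCE IS FLOORED BY THE JEFFREYS DIVERGENCE**: `w, q̃ > 0`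
measurable integrable, `∫ q̃ = 1`, `w log b, q̃ log b ∈ L¹` (`b = w/q̃`); with `Z = ∫ w` and
`J = (∫ w log b)/Z − ∫ q̃ log b` (`= D(π‖q̃) + D(q̃‖π)`):
`∫ w(x) (∫ imhAcceptQ w q̃ x y · q̃(y) dμ) dμ ≥ (1 − √(1 − e^{−J})) · Z`. -/
theorem imh_meanAccept_ge_jeffreys (hw0 : ∀ t, 0 < w t) (hwm : Measurable w) (hwi : Integrable w μ)
    (hq0 : ∀ t, 0 < q t) (hqm : Measurable q) (hqi : Integrable q μ) (hq1 : ∫ z, q z ∂μ = 1)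
    (hwl : Integrable (fun t => Real.log (w t / q t) * w t) μ)
    (hql : Integrable (fun t => Real.log (w t / q t) * q t) μ) :
    (1 - Real.sqrt (1 - Real.exp (-((∫ t, Real.log (w t / q t) * w t ∂μ) / (∫ z, w z ∂μ)
        - ∫ t, Real.log (w t / q t) * q t ∂μ)))) * ∫ z, w z ∂μ
      ≤ ∫ x, w x * (∫ y, imhAcceptQ w q x y * q y ∂μ) ∂μ := by
  set H : X × X → ℝ := fun z => -Real.log (w z.1) - Real.log (q z.2) with hH
  have hHm : Measurable H :=
    ((Real.measurable_log.comp (hwm.comp measurable_fst)).neg).sub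
      (Real.measurable_log.comp (hqm.comp measurable_snd))
  have hΨμ : MeasurePreserving (Prod.swap : X × X → X × X) (μ.prod μ) (μ.prod μ) :=
    Measure.measurePreserving_swap
  have hΨi : Function.Involutive (Prod.swap : X × X → X × X) := fun p => Prod.swap_swap p
  have hZ : 0 < ∫ z, w z ∂μ := integral_pos_of_pos hw0 hwi hq1
  have hexp : Integrable (fun z => Real.exp (-H z)) (μ.prod μ) := by
    have h : Integrable (fun p : X × X => w p.1 * q p.2) (μ.prod μ) := hwi.mul_prod hqi
    exact h.congr (Eventually.of_forall fun p => (swapEnergy_exp_neg hw0 hq0 p).symm)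
  have hZH : ∫ z, Real.exp (-H z) ∂(μ.prod μ) = ∫ z, w z ∂μ := integral_exp_neg_swapEnergy hw0 hq0 hq1
  obtain ⟨hΔi, hΔ⟩ := integral_deltaH_swapEnergy hw0 hwi hq0 hqi hq1 hwl hql
  have key := involutive_acceptance_ge (μ := μ.prod μ) hHm measurable_swap hΨi hΨμ hexp hΔi
    (by rw [hZH]; exact hZ)
  rw [hZH, hΔ] at key
  -- the right side is the iterated acceptance integral
  have hacc : ∫ z, min 1 (Real.exp (-deltaH H Prod.swap z)) * Real.exp (-H z) ∂(μ.prod μ)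
      = ∫ x, w x * (∫ y, imhAcceptQ w q x y * q y ∂μ) ∂μ := by
    have e : (fun z : X × X => min 1 (Real.exp (-deltaH H Prod.swap z)) * Real.exp (-H z))
        = fun z => w z.1 * (imhAcceptQ w q z.1 z.2 * q z.2) := by
      funext z
      rw [imhAcceptQ_eq_min_exp_neg_deltaH hw0 hq0 z, swapEnergy_exp_neg hw0 hq0 z]
      ring
    rw [e]
    have hint : Integrable (fun z : X × X => w z.1 * (imhAcceptQ w q z.1 z.2 * q z.2)) (μ.prod μ) := by
      refine (hwi.mul_prod hqi).mono' ?_ (Eventually.of_forall fun z => ?_)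
      · exact ((hwm.comp measurable_fst).mul
          ((measurable_imhAcceptQ hwm hqm).mul (hqm.comp measurable_snd))).aestronglyMeasurable
      · have ha := imhAcceptQ_nonneg hw0 hq0 z.1 z.2
        have ha1 := imhAcceptQ_le_one w q z.1 z.2
        rw [Real.norm_eq_abs, abs_of_nonneg (mul_nonneg (hw0 _).le (mul_nonneg ha (hq0 _).le))]
        have := mul_le_of_le_one_left (hq0 z.2).le ha1
        exact mul_le_mul_of_nonneg_left this (hw0 _).le
    rw [integral_prod _ hint]
    exact integral_congr_ae (Eventually.of_forall fun x => by
      dsimp only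
      rw [integral_const_mul])
  rw [hacc] at key
  have e2 : (∫ t, Real.log (w t / q t) * w t ∂μ - (∫ z, w z ∂μ) * ∫ t, Real.log (w t / q t) * q t ∂μ)
      / ∫ z, w z ∂μ
      = (∫ t, Real.log (w t / q t) * w t ∂μ) / (∫ z, w z ∂μ) - ∫ t, Real.log (w t / q t) * q t ∂μ := by
    field_simp
  rw [e2] at key
  exact key

/-- **THE TARGET-MEAN REJECTION PROBABILITY IS AT MOST `√(1 − e^{−J})`**: with `r(x) = ∫ (1 − α(x,y)) q̃(y)`
the rejection probability from `x`, `∫ w r ≤ √(1 − e^{−J}) · Z` under the hypotheses of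
`imh_meanAccept_ge_jeffreys`. -/
theorem imh_meanReject_le_jeffreys (hw0 : ∀ t, 0 < w t) (hwm : Measurable w) (hwi : Integrable w μ)
    (hq0 : ∀ t, 0 < q t) (hqm : Measurable q) (hqi : Integrable q μ) (hq1 : ∫ z, q z ∂μ = 1)
    (hwl : Integrable (fun t => Real.log (w t / q t) * w t) μ)
    (hql : Integrable (fun t => Real.log (w t / q t) * q t) μ) :
    ∫ x, w x * (∫ y, (1 - imhAcceptQ w q x y) * q y ∂μ) ∂μ
      ≤ Real.sqrt (1 - Real.exp (-((∫ t, Real.log (w t / q t) * w t ∂μ) / (∫ z, w z ∂μ)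
          - ∫ t, Real.log (w t / q t) * q t ∂μ))) * ∫ z, w z ∂μ := by
  have h := imh_meanAccept_ge_jeffreys hw0 hwm hwi hq0 hqm hqi hq1 hwl hql
  -- `∫ (1 − α) q̃ = 1 − ∫ α q̃` pointwise in `x`
  have hαi : ∀ x, Integrable (fun y => imhAcceptQ w q x y * q y) μ := fun x => by
    refine hqi.mono' ((measurable_imhAcceptQ hwm hqm |>.comp (measurable_const.prodMk measurable_id)).mul
      hqm).aestronglyMeasurable (Eventually.of_forall fun y => ?_)
    rw [Real.norm_eq_abs, abs_of_nonneg (mul_nonneg (imhAcceptQ_nonneg hw0 hq0 x y) (hq0 y).le)]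
    exact mul_le_of_le_one_left (hq0 y).le (imhAcceptQ_le_one w q x y)
  have e : ∀ x, ∫ y, (1 - imhAcceptQ w q x y) * q y ∂μ = 1 - ∫ y, imhAcceptQ w q x y * q y ∂μ := by
    intro x
    have e1 : (fun y => (1 - imhAcceptQ w q x y) * q y) = fun y => q y - imhAcceptQ w q x y * q y :=
      funext fun y => by ring
    rw [e1, integral_sub hqi (hαi x), hq1]
  have e2 : (fun x => w x * (∫ y, (1 - imhAcceptQ w q x y) * q y ∂μ))
      = fun x => w x - w x * (∫ y, imhAcceptQ w q x y * q y ∂μ) := funext fun x => by rw [e x]; ring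
  -- integrability of `x ↦ w x · ∫ α q̃`
  obtain ⟨hr0, hr1, hrm⟩ := rejection_bounds (μ := μ) hw0 hwm hq0 hqm hqi hq1
  have hbound : ∀ x, 0 ≤ ∫ y, imhAcceptQ w q x y * q y ∂μ ∧ ∫ y, imhAcceptQ w q x y * q y ∂μ ≤ 1 := by
    intro x
    have h0 := hr0 x
    have h1 := hr1 x
    rw [e x] at h0 h1
    constructor <;> linarith
  have hm2 : Measurable fun x => ∫ y, imhAcceptQ w q x y * q y ∂μ := by
    have hfun : (fun x => ∫ y, imhAcceptQ w q x y * q y ∂μ) = fun x => 1 - ∫ y, (1 - imhAcceptQ w q x y) * q y ∂μ :=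
      funext fun x => by rw [e x]; ring
    rw [hfun]
    exact measurable_const.sub hrm
  have hint : Integrable (fun x => w x * (∫ y, imhAcceptQ w q x y * q y ∂μ)) μ := by
    refine hwi.mono' (hwm.mul hm2).aestronglyMeasurable (Eventually.of_forall fun x => ?_)
    rw [Real.norm_eq_abs, abs_of_nonneg (mul_nonneg (hw0 x).le (hbound x).1)]
    exact mul_le_of_le_one_right (hw0 x).le (hbound x).2
  rw [e2, integral_sub hwi hint]
  linarith

/-- **THE MEAN SQUARED ACCEPTED LOG-WEIGHT JUMP IS AT MOST `8/e²`, FOR EVERY FLOW** (the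
Caracciolo–Pelissetto–Sokal energy bound of row 2's `InvolutiveMetropolisEnergyBound` through the
dictionary): `∫∫ α(x,y) (log b(x) − log b(y))² w(x) q̃(y) ≤ 8e^{−2} · Z` (`w, q̃ > 0` measurable
integrable, `∫ q̃ = 1`; no measurability or moment hypothesis) — accepted moves of the exact flow sampler cannot change
the log importance weight by much on average, whatever the network. -/
theorem imh_integral_accept_mul_logWeightJump_sq_le (hw0 : ∀ t, 0 < w t)
    (hwi : Integrable w μ) (hq0 : ∀ t, 0 < q t) (hqi : Integrable q μ) (hq1 : ∫ z, q z ∂μ = 1) :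
    ∫ p, imhAcceptQ w q p.1 p.2 * (Real.log (w p.1 / q p.1) - Real.log (w p.2 / q p.2)) ^ 2
        * (w p.1 * q p.2) ∂(μ.prod μ)
      ≤ 8 * Real.exp (-2) * ∫ z, w z ∂μ := by
  set H : X × X → ℝ := fun z => -Real.log (w z.1) - Real.log (q z.2) with hH
  have hΨμ : MeasurePreserving (Prod.swap : X × X → X × X) (μ.prod μ) (μ.prod μ) :=
    Measure.measurePreserving_swap
  have hΨi : Function.Involutive (Prod.swap : X × X → X × X) := fun p => Prod.swap_swap p
  have hexp : Integrable (fun z => Real.exp (-H z)) (μ.prod μ) := by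
    have h : Integrable (fun p : X × X => w p.1 * q p.2) (μ.prod μ) := hwi.mul_prod hqi
    exact h.congr (Eventually.of_forall fun p => (swapEnergy_exp_neg hw0 hq0 p).symm)
  have key := integral_involAccept_mul_deltaH_sq_le (μ := μ.prod μ) (H := H) measurable_swap hΨi hΨμ hexp
  rw [integral_exp_neg_swapEnergy hw0 hq0 hq1] at key
  have e : (fun z : X × X => involAccept H Prod.swap z * (H (Prod.swap z) - H z) ^ 2 * Real.exp (-H z))
      = fun p => imhAcceptQ w q p.1 p.2 * (Real.log (w p.1 / q p.1) - Real.log (w p.2 / q p.2)) ^ 2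
          * (w p.1 * q p.2) := by
    funext z
    rw [involAccept_eq_min_exp_neg_deltaH, imhAcceptQ_eq_min_exp_neg_deltaH hw0 hq0 z,
      show H (Prod.swap z) - H z = deltaH H Prod.swap z from rfl, deltaH_swap_eq hw0 hq0 z,
      swapEnergy_exp_neg hw0 hq0 z]
  rw [e] at key
  exact key

end General

/-! ## §3 Lattice φ⁴ (`λ > 0`, real `J`, any flow with both relative entropies finite) -/

section Lattice

variable {n : ℕ}

/-- **THE φ⁴ FLOW SAMPLER'S ACCEPTANCE IS FLOORED BY THE JEFFREYS DIVERGENCE OF THE FLOW**: `λ > 0`,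
real `J`, any positive measurable flow `q̃` with `∫ q̃ = 1` and `e^{−S} log b, q̃ log b ∈ L¹`
(`b = e^{−S}/q̃`): with `Jf = ⟨log b⟩_S − ∫ q̃ log b` (`= D(π‖q̃) + D(q̃‖π)`),
`∫ e^{−S(φ)} (∫ imhAcceptQ e^{−S} q̃ φ φ' · q̃(φ') dφ') dφ ≥ (1 − √(1 − e^{−Jf})) · Z`. -/
theorem phi4Flow_meanAccept_ge_jeffreys {lam : ℝ} (hlam : 0 < lam)
    (J : Fin (n + 1) → Fin (n + 1) → ℝ) {q : (Fin (n + 1) → ℝ) → ℝ} (hq0 : ∀ φ, 0 < q φ)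
    (hqm : Measurable q) (hqi : Integrable q) (hq1 : ∫ φ, q φ = 1)
    (hwl : Integrable (fun φ => Real.log (gibbsWeight J lam φ / q φ) * gibbsWeight J lam φ))
    (hql : Integrable (fun φ => Real.log (gibbsWeight J lam φ / q φ) * q φ)) :
    (1 - Real.sqrt (1 - Real.exp (-(gibbsExpect J lam (fun φ => Real.log (gibbsWeight J lam φ / q φ))
        - ∫ φ, Real.log (gibbsWeight J lam φ / q φ) * q φ)))) * gibbsZ J lam
      ≤ ∫ φ, gibbsWeight J lam φ * (∫ φ', imhAcceptQ (gibbsWeight J lam) q φ φ' * q φ') := by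
  have h := imh_meanAccept_ge_jeffreys (μ := volume) (fun φ => gibbsWeight_pos J lam φ)
    (continuous_gibbsWeight J lam).measurable (integrable_gibbsWeight hlam J) hq0 hqm hqi hq1 hwl hql
  unfold gibbsExpect
  exact h

end Lattice

end Summit.Ventures.LatticeQCDFlow.Exactness
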